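import Literature.Analysis.FluidPDE.SelfSimilarEulerOutgoingFlatVorticity
import Literature.Analysis.FluidPDE.SelfSimilarEulerOutgoingAnalytic
import Mathlib.Topology.Separation.Connected
import HarnessLib

/-!
# Constantin–Ignatova–Vicol 2026, §4.2: the nodal set of an axisymmetric outgoing profile lies on
# the axis, and Theorem 4.3 — proofs companion

Analysis/FluidPDE proofs file (theorems only: no definitions, no named facts, no `sorry`), in the
story of `SelfSimilarEulerProfile.lean` / `SelfSimilarEulerOutgoing.lean` (CIV **Thm 3.8**,
proved) / `SelfSimilarEulerOutgoingFlatVorticity.lean` (CIV **Prop 3.9**, orders `0, 1`, proved) /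
`SelfSimilarEulerOutgoingAnalytic.lean` (CIV **Thm 3.10**, named fact) /
`SelfSimilarEulerSwirlingFixedPoint.lean` (CIV **Thm 4.4**, proved). P. Constantin, M. Ignatova,
V. Vicol, *On putative self-similarity for incompressible 3D Euler* (arXiv:2602.17570, 2026),
§4.2 "Consequences of an axisymmetric outgoing property":

> "… for any point `y_*` on the circle `(r_*, θ, z_*)_{θ ∈ [0,2π]}` we have that `V(y_*) = 0` (by
> axisymmetry). Thus, if we insist on the finiteness of the nodal set `𝒩_V ⊂ ℝ³`, as required by
> Definition 3.7, it follows that `r_* = 0`; … Hence the finiteness of `𝒩_V` implies that all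
> nodal values of `V` must lie on the axis of symmetry."
>
> **Theorem 4.3.** Let `U ≢ 0` be a `C²` smooth axisymmetric similarity profile solving (4.1).
> Then: (i) Let `(0, z_*)` be a zero of `V`. If `Ω_z(0, z_*) ≠ 0` and if the outgoing property
> (4.5) holds locally near `(0, z_*)` for some `c_* ≥ 0`, then `γ ≥ 1/2 + c_*`. (ii) If the nodal
> set `𝒩_V ⊂ ℝ³` is finite, the outgoing property (4.5) holds locally in the vicinity of all nodal
> values `(0, z_*)` for some `c_* ≥ 0`, and if `Ω` is real-analytic at each of these nodal values,
> then `γ ≥ 1/2`.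

(CIV: "We record the results of Theorems 3.8 and 3.10 in the axisymmetric setting"; (4.5),
`r V_r + (z − z_*) V_z ≥ c_*(r² + (z − z_*)²)`, is (3.37) `V(y)·(y − y_*) ≥ c_*|y − y_*|²` at an
on-axis node `y_* = (0, 0, z_*)`, written in cylindrical components.)

## What is here (all PROVED)

* `IsAxisymmetric.selfSimilarTransport_rotZ`, `IsAxisymmetric.rotZ_mem_selfSimilarNodalSet` —
  for an axisymmetric `U` and a centre `c` on the axis, `V = γ(y − c) + U` is rotation-equivariant
  and its nodal set is rotation-invariant;
* `onAxis_of_mem_selfSimilarNodalSet_of_finite` — **§4.2**: if `𝒩_V` is finite then every node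
  lies on the axis (the orbit `θ ↦ R_θ y_*` of an off-axis node is a connected set with two
  distinct points, hence infinite); packaged with Definition 3.7 as
  `IsLocallyOutgoing.onAxis_of_mem_selfSimilarNodalSet`;
* `IsSelfSimilarEulerProfile.half_add_le_of_outgoing_of_axialVorticity` — **Thm 4.3 (i)** (from
  the tree's Thm 3.8; axisymmetry is not needed for this implication, only `Ω_z(y_*) ≠ 0 ⇒
  Ω(y_*) ≠ 0`);
* `CIV2026_half_le_of_isLocallyOutgoing_of_analyticAt.of_isAxisymmetric` — **Thm 4.3 (ii)** given
  the Thm 3.10 fact: for axisymmetric profiles analyticity of `Ω` is needed at the ON-AXIS nodes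
  only;
* `IsSelfSimilarEulerProfile.curl_eq_zero_of_isLocallyOutgoing_of_isAxisymmetric` — Prop 3.9
  (order `0`) recorded the same way: in the window `γ < ½ + c_*` the axial vorticity `Ω_z`
  vanishes at every (on-axis) node.

## References

* P. Constantin, M. Ignatova, V. Vicol, arXiv:2602.17570v3 (2026), §4.2 (p. 13, the paragraph
  before (4.5)) and Theorem 4.3 (pp. 13–14). [ConstantinIgnatovaVicol2026Putative]
-/

noncomputable section

open Set InnerProductSpace
open scoped RealInnerProductSpace

namespace Literature.Analysis.FluidPDE

section AxisymmetricOutgoing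

variable {γ : ℝ} {c : EuclideanSpace ℝ (Fin 3)}
variable {U : EuclideanSpace ℝ (Fin 3) → EuclideanSpace ℝ (Fin 3)} {P : EuclideanSpace ℝ (Fin 3) → ℝ}

/-- A point on the axis is fixed by the rotations about the axis. [folklore] -/
private theorem rotZ_of_onAxis' (θ : ℝ) {c : EuclideanSpace ℝ (Fin 3)} (hc : c 0 = 0 ∧ c 1 = 0) :
    rotZ θ c = c := by
  ext i
  fin_cases i <;> simp [hc.1, hc.2]

/-- The orbit map `θ ↦ R_θ y` is continuous. [folklore] -/
private theorem continuous_rotZ_angle' (y : EuclideanSpace ℝ (Fin 3)) :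
    Continuous fun θ : ℝ => rotZ θ y := by
  unfold rotZ
  refine (PiLp.continuous_toLp 2 _).comp (continuous_pi fun i => ?_)
  fin_cases i
  · exact ((Real.continuous_cos.mul (continuous_const (y := y 0))).sub
      (Real.continuous_sin.mul (continuous_const (y := y 1)))).congr fun θ => by simp
  · exact ((Real.continuous_sin.mul (continuous_const (y := y 0))).add
      (Real.continuous_cos.mul (continuous_const (y := y 1)))).congr fun θ => by simp
  · exact (continuous_const (y := y 2)).congr fun θ => by simp

/-- The half-turn about the axis moves every point off the axis. [folklore] -/
private theorem rotZ_pi_ne_of_offAxis {y : EuclideanSpace ℝ (Fin 3)} (hy : ¬(y 0 = 0 ∧ y 1 = 0)) :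
    rotZ Real.pi y ≠ y := by
  intro h
  have h0 := congrArg (· 0) h
  have h1 := congrArg (· 1) h
  simp only [rotZ_apply_zero, rotZ_apply_one, Real.cos_pi, Real.sin_pi] at h0 h1
  exact hy ⟨by linarith, by linarith⟩

/-- **The transport field of an axisymmetric profile is rotation-equivariant**: for `U`
axisymmetric and a centre `c` on the axis, `V(R_θ y) = R_θ V(y)`, `V = γ(y − c) + U` (CIV §4.2:
`V = V_r e_r + U_θ e_θ + V_z e_z` with angle-independent components).
[cite: ConstantinIgnatovaVicol2026Putative, §4.2 (before (4.5))] -/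
theorem IsAxisymmetric.selfSimilarTransport_rotZ (hU : IsAxisymmetric U) (hc : c 0 = 0 ∧ c 1 = 0)
    (γ : ℝ) (θ : ℝ) (y : EuclideanSpace ℝ (Fin 3)) :
    selfSimilarTransport γ c U (rotZ θ y) = rotZ θ (selfSimilarTransport γ c U y) := by
  rw [selfSimilarTransport_apply, selfSimilarTransport_apply, hU θ y]
  conv_lhs => rw [← rotZ_of_onAxis' θ hc]
  rw [← rotZL_apply, ← rotZL_apply, ← rotZL_apply, ← rotZL_apply, map_add, map_smul, map_sub]

/-- **The nodal set of an axisymmetric profile is rotation-invariant** (CIV §4.2: "for any point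
`y_*` on the circle `(r_*, θ, z_*)_θ` we have that `V(y_*) = 0` (by axisymmetry)").
[cite: ConstantinIgnatovaVicol2026Putative, §4.2 (before (4.5))] -/
theorem IsAxisymmetric.rotZ_mem_selfSimilarNodalSet (hU : IsAxisymmetric U)
    (hc : c 0 = 0 ∧ c 1 = 0) {y : EuclideanSpace ℝ (Fin 3)} (hy : y ∈ selfSimilarNodalSet γ c U)
    (θ : ℝ) : rotZ θ y ∈ selfSimilarNodalSet γ c U := by
  change selfSimilarTransport γ c U (rotZ θ y) = 0
  have hy' : selfSimilarTransport γ c U y = 0 := hy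
  rw [hU.selfSimilarTransport_rotZ hc, hy', ← rotZL_apply, map_zero]

/-- **CIV §4.2: a finite nodal set of an axisymmetric profile lies on the axis.** If `U` is
axisymmetric, the centre `c` is on the axis and `𝒩_V` is finite, then every `y_* ∈ 𝒩_V` has
`r_* = 0` ("the aforementioned circle contracts onto a point"): otherwise the orbit
`{R_θ y_*}_θ ⊆ 𝒩_V` is a connected set containing the two distinct points `y_*` and `R_π y_*`,
hence infinite. [cite: ConstantinIgnatovaVicol2026Putative, §4.2 (before (4.5))] -/
theorem onAxis_of_mem_selfSimilarNodalSet_of_finite (hU : IsAxisymmetric U)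
    (hc : c 0 = 0 ∧ c 1 = 0) (hfin : (selfSimilarNodalSet γ c U).Finite)
    {y : EuclideanSpace ℝ (Fin 3)} (hy : y ∈ selfSimilarNodalSet γ c U) : y 0 = 0 ∧ y 1 = 0 := by
  by_contra hoff
  have hsub : range (fun θ : ℝ => rotZ θ y) ⊆ selfSimilarNodalSet γ c U := by
    rintro _ ⟨θ, rfl⟩
    exact hU.rotZ_mem_selfSimilarNodalSet hc hy θ
  have hconn : IsPreconnected (range fun θ : ℝ => rotZ θ y) :=
    isPreconnected_range (continuous_rotZ_angle' y)
  have hnontriv : (range fun θ : ℝ => rotZ θ y).Nontrivial :=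
    ⟨rotZ Real.pi y, ⟨Real.pi, rfl⟩, y, ⟨0, rotZ_zero y⟩, rotZ_pi_ne_of_offAxis hoff⟩
  exact (hconn.infinite_of_nontrivial hnontriv) (hfin.subset hsub)

/-- **CIV §4.2 with Definition 3.7**: under the local outgoing property (which includes the
finiteness of `𝒩_V`), every stagnation point of an axisymmetric profile with centre on the axis
lies on the axis, `𝒩_V = {(0, 0, z_j)}`. [cite: ConstantinIgnatovaVicol2026Putative, §4.2 (before (4.5))] -/
theorem IsLocallyOutgoing.onAxis_of_mem_selfSimilarNodalSet {κ ε : ℝ}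
    (hout : IsLocallyOutgoing γ c U κ ε) (hU : IsAxisymmetric U) (hc : c 0 = 0 ∧ c 1 = 0)
    {y : EuclideanSpace ℝ (Fin 3)} (hy : y ∈ selfSimilarNodalSet γ c U) : y 0 = 0 ∧ y 1 = 0 :=
  onAxis_of_mem_selfSimilarNodalSet_of_finite hU hc hout.nodalSet_finite hy

/-- **CIV Theorem 4.3 (i).** At a stagnation point `y_*` of `V = γ(y − c) + U` near which the
outgoing inequality `V(y)·(y − y_*) ≥ c_*|y − y_*|²` holds (`|y − y_*| ≤ ε_*`; for `y_*` on the
axis this is (4.5), `r V_r + (z − z_*)V_z ≥ c_*(r² + (z − z_*)²)`), a non-vanishing AXIAL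
vorticity `Ω_z(y_*) ≠ 0` forces `γ ≥ ½ + c_*` — Theorem 3.8 of the tree
(`half_add_le_of_outgoing`), since `Ω_z(y_*) ≠ 0 ⇒ Ω(y_*) ≠ 0`; the axisymmetry of the printed
statement is not used by the implication. [cite: ConstantinIgnatovaVicol2026Putative, §4.2 Thm. 4.3 (i)] -/
theorem IsSelfSimilarEulerProfile.half_add_le_of_outgoing_of_axialVorticity
    (h : IsSelfSimilarEulerProfile γ c U P) {z : EuclideanSpace ℝ (Fin 3)}
    (hz : z ∈ selfSimilarNodalSet γ c U) (hΩ : curl U z 2 ≠ 0) {κ ε : ℝ} (hε : 0 < ε)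
    (hout : ∀ y, ‖y - z‖ ≤ ε → κ * ‖y - z‖ ^ 2 ≤ ⟪selfSimilarTransport γ c U y, y - z⟫) :
    1 / 2 + κ ≤ γ :=
  h.isSelfSimilarEulerVorticityProfile.half_add_le_of_outgoing hz
    (fun h0 => hΩ (by rw [h0]; rfl)) hε hout

/-- **CIV Theorem 4.3 (i) with Definition 3.7.** [cite: ConstantinIgnatovaVicol2026Putative, §4.2 Thm. 4.3 (i)] -/
theorem IsSelfSimilarEulerProfile.half_add_le_of_isLocallyOutgoing_of_axialVorticity
    (h : IsSelfSimilarEulerProfile γ c U P) {κ ε : ℝ} (hout : IsLocallyOutgoing γ c U κ ε)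
    {z : EuclideanSpace ℝ (Fin 3)} (hz : z ∈ selfSimilarNodalSet γ c U) (hΩ : curl U z 2 ≠ 0) :
    1 / 2 + κ ≤ γ :=
  h.half_add_le_of_outgoing_of_axialVorticity hz hΩ hout.pos (hout.outgoing z hz)

/-- **CIV Theorem 4.3 (ii)** (given the Theorem 3.10 fact): for a nontrivial AXISYMMETRIC `C²`
profile with centre on the axis, the far-field bounds (3.8) and the local outgoing property, it
suffices to assume `Ω` real-analytic at the ON-AXIS nodes `(0, 0, z_j)` — by §4.2 there are no
others — to conclude `γ ≥ ½`. [cite: ConstantinIgnatovaVicol2026Putative, §4.2 Thm. 4.3 (ii)] -/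
theorem CIV2026_half_le_of_isLocallyOutgoing_of_analyticAt.of_isAxisymmetric
    (hfact : CIV2026_half_le_of_isLocallyOutgoing_of_analyticAt) (hγ : 0 < γ)
    (h : IsSelfSimilarEulerProfile γ c U P) (hU : IsAxisymmetric U) (hc : c 0 = 0 ∧ c 1 = 0)
    (hfar : HasSelfSimilarFarField γ c U) (hU0 : U ≠ 0) {κ ε : ℝ}
    (hout : IsLocallyOutgoing γ c U κ ε)
    (han : ∀ z ∈ selfSimilarNodalSet γ c U, z 0 = 0 ∧ z 1 = 0 → AnalyticAt ℝ (curl U) z) :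
    (1 : ℝ) / 2 ≤ γ :=
  hfact hγ h hfar hU0 hout fun z hz => han z hz (hout.onAxis_of_mem_selfSimilarNodalSet hU hc hz)

/-- **CIV Proposition 3.9 (order `0`) in the axisymmetric setting**: in the window `γ < ½ + c_*`,
at every stagnation point of a locally outgoing axisymmetric profile (all of which lie on the
axis) the vorticity — in particular its axial component `Ω_z(0, 0, z_j)`, the only one that can
survive on the axis — vanishes. [cite: ConstantinIgnatovaVicol2026Putative, §3.5 Prop. 3.9 with §4.2 Thm. 4.3] -/
theorem IsSelfSimilarEulerProfile.curl_eq_zero_of_isLocallyOutgoing_of_isAxisymmetric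
    (h : IsSelfSimilarEulerProfile γ c U P) (hU : IsAxisymmetric U) (hc : c 0 = 0 ∧ c 1 = 0)
    {κ ε : ℝ} (hout : IsLocallyOutgoing γ c U κ ε) (hγ : γ < 1 / 2 + κ)
    {z : EuclideanSpace ℝ (Fin 3)} (hz : z ∈ selfSimilarNodalSet γ c U) :
    (z 0 = 0 ∧ z 1 = 0) ∧ curl U z = 0 :=
  ⟨hout.onAxis_of_mem_selfSimilarNodalSet hU hc hz, h.curl_eq_zero_of_isLocallyOutgoing hout hγ hz⟩

end AxisymmetricOutgoing

end Literature.Analysis.FluidPDE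

end
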